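import Summits.QuantumFields.YangMills.Theorems.NPointIsotropy.Negative.NPointRegularJunk
import Summits.QuantumFields.YangMills.Theorems.PencilRigidityNPointIsotropyMopup
import Literature.MathematicalPhysics.QuantumLattice.SchwingerOSPositivity

/-!
# `PencilRigidity.NPointIsotropy`, line `quarter-turn-corner-operator`: helpers for stub `stub_unorderedRP`, II
# (time-ordered pieces of a positive-time test function)

Support file (helpers, part II) for stub `stub_unorderedRP` (B1, unordered reflection positivity on `⁰𝒮` from the
function residual) of crux `stmt-QuantumFields-11686` (`Summit.QuantumFields.YangMills.Theses.PencilRigidity.NPointIsotropy`),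
line `quarter-turn-corner-operator`. Namespace `…NPointIsotropy.QuarterTurnCornerOperator` (helpers in
`…QuarterTurnCornerOperator.UnorderedRP`); no `def`.

Content: the **sector decomposition with wall cut-offs** (`unorderedRPCutoff`). For an `n`-point test function `F`
supported in the UNORDERED positive-time region `{∀ i, xᵢ⁰ > 0}` (OS's `𝒮₊`) and every `k ∈ ℕ` there are
time-ORDERED test functions `T_{k,π} ∈ 𝒮_<` (`π ∈ 𝔖ₙ`) with `∑_π (T_{k,π})^π = c_k · F` pointwise, where the
multipliers `c_k : (ℝ⁴)ⁿ → [0, n!]` converge to `1` (indeed are eventually `1`) at every configuration with pairwise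
distinct times. Construction: the open sectors `G_π = {x | x⁰_{π 0} < ⋯ < x⁰_{π (n-1)}}` are pairwise disjoint with
Lebesgue-conull union; take smooth compactly supported exhaustions `χ_{k,π} → 1_{G_π}` (tree,
`Mopup.exists_smooth_exhaustion`), the compactly supported Schwartz functions `P_{k,π} = χ_{k,π} F`
(`HasCompactSupport.toSchwartzMap`) and `T_{k,π} = (P_{k,π})^{π⁻¹}`; the sorting permutation (`Tuple.sort`) is the
unique sector containing a configuration with distinct times. This is the regularisation through which ORDERED
reflection positivity (E2 on `𝒮_<`) reaches unordered positive-time supports.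

References: K. Osterwalder, R. Schrader, Comm. Math. Phys. 31 (1973) §2 (`𝒮₊`, `𝒮_<`); ibid. 42 (1975) §4;
folklore.
-/

noncomputable section

namespace Summit.QuantumFields.YangMills.Theorems.NPointIsotropy.QuarterTurnCornerOperator

open scoped BigOperators SchwartzMap ComplexConjugate ContDiff
open MeasureTheory Filter Topology
open Literature.MathematicalPhysics.QuantumLattice Literature.MathematicalPhysics.AQFT
open Summit.QuantumFields.YangMills.Theorems.NPointIsotropy.Negative (E4)
open Summit.QuantumFields.YangMills.Theorems.NPointIsotropy.ComplexRotationBandlimit (Mopup.exists_smooth_exhaustion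
  Mopup.continuous_coord)

namespace UnorderedRP

variable {n : ℕ}

/-- The time-ordering sector of a permutation `π`, `{x | i ↦ x⁰_{π i} strictly increasing}`, is open. [folklore] -/
theorem isOpen_setOf_strictMono (π : Equiv.Perm (Fin n)) :
    IsOpen {x : Fin n → E4 | StrictMono fun i => x (π i) 0} := by
  have hset : {x : Fin n → E4 | StrictMono fun i => x (π i) 0} =
      ⋂ i : Fin n, ⋂ j : Fin n, {x : Fin n → E4 | i < j → x (π i) 0 < x (π j) 0} := by
    ext x
    simp only [Set.mem_setOf_eq, Set.mem_iInter]
    exact Iff.rfl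
  rw [hset]
  refine isOpen_iInter_of_finite fun i => isOpen_iInter_of_finite fun j => ?_
  by_cases hij : i < j
  · simp only [hij, forall_true_left]
    exact isOpen_lt (Mopup.continuous_coord (π i) 0) (Mopup.continuous_coord (π j) 0)
  · simp [hij]

/-- A configuration with pairwise distinct times lies in exactly one sector: that of its sorting permutation
(`Tuple.sort`). [folklore] -/
theorem strictMono_iff_eq_sort {x : Fin n → E4} (hx : Function.Injective fun i => x i 0) (π : Equiv.Perm (Fin n)) :
    StrictMono (fun i => x (π i) 0) ↔ π = Tuple.sort fun i => x i 0 := by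
  constructor
  · intro hπ
    exact Tuple.eq_sort_iff.2 ⟨hπ.monotone, fun i j hij h => absurd h (hπ hij).ne⟩
  · rintro rfl
    exact (Tuple.monotone_sort fun i => x i 0).strictMono_of_injective
      (hx.comp (Tuple.sort fun i => x i 0).injective)

/-- **Sector decomposition with wall cut-offs.** For a positive-time `n`-point test function `F` and every `k` there
are time-ordered `T_{k,π}` (`π ∈ 𝔖ₙ`) and a multiplier `c_k : (ℝ⁴)ⁿ → [0, n!]` with `∑_π (T_{k,π})^π = c_k F`, and
`c_k(x) = 1` eventually at every `x` with pairwise distinct times. [folklore] -/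
theorem exists_orderedPieces (F : 𝓢((Fin n → E4), ℂ)) (hF : IsPositiveTimeMulti F) :
    ∃ (T : ℕ → Equiv.Perm (Fin n) → 𝓢((Fin n → E4), ℂ)) (c : ℕ → (Fin n → E4) → ℝ),
      (∀ k π, IsTimeOrdered (T k π)) ∧
      (∀ k x, (∑ π, permTest π (T k π)) x = (c k x : ℂ) * F x) ∧
      (∀ k x, 0 ≤ c k x ∧ c k x ≤ (Fintype.card (Equiv.Perm (Fin n)) : ℝ)) ∧
      (∀ x : Fin n → E4, Function.Injective (fun i => x i 0) → ∀ᶠ k in atTop, c k x = 1) := by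
  -- smooth compactly supported exhaustions of the sectors
  choose χ hχs hχc hχG hχ01 hχ1 hχ0 using fun π : Equiv.Perm (Fin n) =>
    Mopup.exists_smooth_exhaustion (isOpen_setOf_strictMono (n := n) π)
  -- the pieces `χ_{k,π} F`
  have hcs : ∀ π k, HasCompactSupport fun x : Fin n → E4 => (χ π k x : ℂ) * F x := fun π k =>
    ((hχc π k).comp_left Complex.ofReal_zero).mul_right
  have hsm : ∀ π k, ContDiff ℝ ∞ fun x : Fin n → E4 => (χ π k x : ℂ) * F x := fun π k =>
    (Complex.ofRealCLM.contDiff.comp (hχs π k)).mul (F.smooth _)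
  set P : ℕ → Equiv.Perm (Fin n) → 𝓢((Fin n → E4), ℂ) := fun k π => (hcs π k).toSchwartzMap (hsm π k)
    with hPdef
  have hP : ∀ k π x, P k π x = (χ π k x : ℂ) * F x := fun _ _ _ => rfl
  have hPsupp : ∀ k π, tsupport ((P k π : 𝓢((Fin n → E4), ℂ)) : (Fin n → E4) → ℂ) ⊆
      {x : Fin n → E4 | StrictMono fun i => x (π i) 0} ∩ tsupport (F : (Fin n → E4) → ℂ) := by
    intro k π x hx
    have hfun : ((P k π : 𝓢((Fin n → E4), ℂ)) : (Fin n → E4) → ℂ) = fun x => (χ π k x : ℂ) * F x := rfl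
    rw [hfun] at hx
    exact ⟨hχG π k ((tsupport_mul_subset_left.trans (tsupport_comp_subset Complex.ofReal_zero _)) hx),
      tsupport_mul_subset_right hx⟩
  refine ⟨fun k π => permTest π.symm (P k π), fun k x => ∑ π, χ π k x, ?_, ?_, ?_, ?_⟩
  · -- the pieces are time-ordered after sorting their arguments
    intro k π x hx
    have hfun : ((permTest π.symm (P k π) : 𝓢((Fin n → E4), ℂ)) : (Fin n → E4) → ℂ) =
        ((P k π : 𝓢((Fin n → E4), ℂ)) : (Fin n → E4) → ℂ) ∘ fun y : Fin n → E4 => y ∘ ⇑π.symm :=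
      funext fun y => permTest_apply _ _ _
    have hcont : Continuous fun y : Fin n → E4 => y ∘ ⇑π.symm := continuous_pi fun i => continuous_apply _
    rw [hfun] at hx
    obtain ⟨h1, h2⟩ := hPsupp k π (tsupport_comp_subset_preimage _ hcont hx)
    have hpos : ∀ i, 0 < (x ∘ ⇑π.symm) i 0 := hF h2
    refine ⟨fun i => ?_, ?_⟩
    · have := hpos (π i)
      simpa using this
    · have h1' : StrictMono fun i => (x ∘ ⇑π.symm) (π i) 0 := h1
      simpa using h1'
  · -- `∑_π (T_{k,π})^π = (∑_π χ_{k,π}) F`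
    intro k x
    rw [sum_apply]
    have hterm : ∀ π : Equiv.Perm (Fin n), permTest π (permTest π.symm (P k π)) x = (χ π k x : ℂ) * F x := by
      intro π
      rw [permTest_apply, permTest_apply, Function.comp_assoc, Equiv.self_comp_symm, Function.comp_id, hP]
    simp only [hterm, ← Finset.sum_mul, Complex.ofReal_sum]
  · -- `0 ≤ c_k ≤ n!`
    intro k x
    refine ⟨Finset.sum_nonneg fun π _ => (hχ01 π k x).1, ?_⟩
    calc ∑ π, χ π k x ≤ ∑ _π : Equiv.Perm (Fin n), (1 : ℝ) := Finset.sum_le_sum fun π _ => (hχ01 π k x).2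
      _ = (Fintype.card (Equiv.Perm (Fin n)) : ℝ) := by simp
  · -- eventually `c_k(x) = 1` off the equal-time walls
    intro x hx
    set π₀ : Equiv.Perm (Fin n) := Tuple.sort fun i => x i 0 with hπ₀
    have hx₀ : x ∈ {y : Fin n → E4 | StrictMono fun i => y (π₀ i) 0} := (strictMono_iff_eq_sort hx π₀).2 rfl
    filter_upwards [hχ1 π₀ x hx₀] with k hk
    rw [Finset.sum_eq_single π₀ (fun π _ hne => ?_) (fun h => absurd (Finset.mem_univ π₀) h), hk]
    exact hχ0 π x (fun hπ => hne ((strictMono_iff_eq_sort hx π).1 hπ)) k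

end UnorderedRP

/-- **Registered sub-goal of stub `stub_unorderedRP` (helpers, part II): sector decomposition with wall cut-offs.**
For an `n`-point test function `F` supported in the unordered positive-time region and every `k ∈ ℕ` there are
time-ordered test functions `T_{k,π}` (`π ∈ 𝔖ₙ`) and a multiplier `c_k` with values in `[0, n!]` such that
`∑_π (T_{k,π})^π = c_k · F` pointwise and `c_k(x) = 1` for all large `k` at every configuration `x` with pairwise
distinct times. [folklore] -/
theorem unorderedRPCutoff :
    open Literature.MathematicalPhysics.QuantumLattice Literature.MathematicalPhysics.AQFT
      Summit.QuantumFields.YangMills.Theorems.NPointIsotropy.Negative in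
    ∀ (n : ℕ) (F : SchwartzMap (Fin n → E4) ℂ), IsPositiveTimeMulti F →
      ∃ (T : ℕ → Equiv.Perm (Fin n) → SchwartzMap (Fin n → E4) ℂ) (c : ℕ → (Fin n → E4) → ℝ),
        (∀ k π, IsTimeOrdered (T k π)) ∧
        (∀ k x, (∑ π, permTest π (T k π)) x = (c k x : ℂ) * F x) ∧
        (∀ k x, 0 ≤ c k x ∧ c k x ≤ (Fintype.card (Equiv.Perm (Fin n)) : ℝ)) ∧
        (∀ x : Fin n → E4, Function.Injective (fun i => x i 0) → ∀ᶠ k in Filter.atTop, c k x = 1) :=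
  fun _ F hF => UnorderedRP.exists_orderedPieces F hF

end Summit.QuantumFields.YangMills.Theorems.NPointIsotropy.QuarterTurnCornerOperator

end
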